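import Summits.CriticalPhenomena.Ising3DConformalLimit.Theorems.PrecisionLaplacianDirectCorrelationStableTailPickInversionAux7
import Summits.CriticalPhenomena.Ising3DConformalLimit.Theorems.PrecisionLaplacianDirectCorrelationStableTailPickInversionAux5
import Summits.CriticalPhenomena.Ising3DConformalLimit.Theorems.PrecisionLaplacianDirectCorrelationStableTailPickInversionAux2
import Literature.Probability.LatticeModels.AxisSpectralRepresentationProofs

/-!
# Pick inversion, auxiliary file 8: the Pick inversion theorem for reciprocal Poisson mixtures

Helper file for stub `stub_pickInversion` of line `self-energy-pick-inversion`, crux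
`PrecisionLaplacian.DirectCorrelationStableTail` (stmt-CriticalPhenomena-4799). Pure theorem file.

**Theorem** (`hausdorff_of_inv_hasSum_cos`, registered sub-goal `stub_pickInversion_auxPickInversion`;
THE LEVER of the line, in abstract form). Let `g : ℝ → ℝ` be continuous, even, `2π`-periodic and
positive, whose cosine moments are the moments of a finite positive measure `μ` on `[0, 1]`,
`∫_{-π}^{π} g(θ) cos(nθ) dθ = ∫ tⁿ dμ(t)` (`n : ℕ`), and let `1/g(θ) = ∑ₘ cₘ cos(mθ)` with
`∑ |cₘ| < ∞`. Then `(-cₙ/2)_{n ≥ 1}` is a shifted Hausdorff moment sequence: there is a finite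
positive measure `τ` on `[0, 1]` with `-cₙ/2 = ∫ t^{n-1} dτ(t)` for all `n ≥ 1`.

Proof: `2π g(θ) = F(cos θ)` with `F` the Poisson transform of `μ` (file 2); `-1/F` is Pick and its
Nevanlinna measure `ρ` lives on `[1, ∞)` with no atom at `1` and `∫ dρ/(s(s-1)) < ∞` (files 3–6);
reading the cosine coefficients of `1/g(θ) = -2π(b + β cos θ + π⁻¹∫(1/(s - cos θ) - s/(1+s²)) dρ)`
(file 7) gives `-cₙ/2 = πβ δ_{n1} + 2∫ λ(s)ⁿ/√(s²-1) dρ(s)`, the moments of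
`τ = πβ δ₀ + λ_*(2λ/√(s²-1) dρ)` (`exists_shifted_moment_measure`). References: Donoghue (1974)
Ch. II; Schilling–Song–Vondraček, *Bernstein functions* (2012), Thm 6.2; Akhiezer, *The classical
moment problem*.
-/

noncomputable section

namespace Summit.CriticalPhenomena.Ising3DConformalLimit.Cruxes.DirectCorrelationStableTail.SelfEnergyPickInversion

open MeasureTheory Filter Topology Set Real
open scoped BigOperators ENNReal NNReal
open Literature.Analysis.Complex
open Literature.Probability.LatticeModels (AxisSpectral.integrable_dirac_real)

/-! ### The measure `τ = πβ δ₀ + λ_*(2λ/√(s²-1) dρ)` -/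

/-- **The shifted moment measure.** For `β ≥ 0` and a measure `ρ` with `ρ`-a.e. `s > 1` and
`∫ dρ/(s(s - 1)) < ∞`, there is a finite positive measure `τ` on `[0, 1]` with
`∫ t^{n-1} dτ = πβ [n = 1] + 2 ∫ λ(s)ⁿ/√(s² - 1) dρ(s)` for all `n ≥ 1`, `λ(s) = s - √(s² - 1)`:
`τ = πβ δ₀ + λ_*(2λ/√(s² - 1) · ρ)`. [folklore] -/
theorem exists_shifted_moment_measure {β : ℝ} (hβ : 0 ≤ β) {ρ : Measure ℝ} (hae : ∀ᵐ s ∂ρ, 1 < s)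
    (hu : Integrable (fun s : ℝ => (s * (s - 1))⁻¹) ρ) :
    ∃ τ : Measure ℝ, IsFiniteMeasure τ ∧ τ (Set.Icc (0 : ℝ) 1)ᶜ = 0 ∧ ∀ n : ℕ, 1 ≤ n →
      ∫ t, t ^ (n - 1) ∂τ = π * β * (if n = 1 then 1 else 0) +
        2 * ∫ s, (s - Real.sqrt (s ^ 2 - 1)) ^ n / Real.sqrt (s ^ 2 - 1) ∂ρ := by
  have hπ := Real.pi_pos
  set lam : ℝ → ℝ := fun s => s - Real.sqrt (s ^ 2 - 1) with hlam
  set d : ℝ → ℝ := fun s => 2 * lam s / Real.sqrt (s ^ 2 - 1) with hd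
  have hlam_meas : Measurable lam := by simp only [hlam]; fun_prop
  have hd_meas : Measurable d := by simp only [hd, hlam]; fun_prop
  have hd_nonneg : ∀ s : ℝ, 1 < s → 0 ≤ d s := fun s hs => by
    simp only [hd, hlam]
    exact div_nonneg (mul_nonneg zero_le_two (cheb_lambda_mem hs).1.le) (Real.sqrt_nonneg _)
  have hd_le : ∀ s : ℝ, 1 < s → d s ≤ 2 * (s * (s - 1))⁻¹ := fun s hs => by
    have h := (cheb_weight_bounds hs).2.2.2
    simp only [hd, hlam]
    rw [mul_div_assoc, ← one_div]
    linarith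
  have hd_int : Integrable d ρ := by
    refine Integrable.mono' (hu.const_mul 2) hd_meas.aestronglyMeasurable ?_
    filter_upwards [hae] with s hs
    rw [Real.norm_eq_abs, abs_of_nonneg (hd_nonneg s hs)]
    exact hd_le s hs
  set ν : Measure ℝ := ρ.withDensity fun s => ENNReal.ofReal (d s) with hν
  haveI : IsFiniteMeasure ν := isFiniteMeasure_withDensity_ofReal hd_int.2
  have hνρ : ν ≪ ρ := withDensity_absolutelyContinuous _ _
  have haeν : ∀ᵐ s ∂ν, 1 < s := hνρ.ae_le hae
  set τ : Measure ℝ := (π * β).toNNReal • Measure.dirac 0 + ν.map lam with hτ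
  refine ⟨τ, inferInstance, ?_, fun n hn => ?_⟩
  · -- support
    rw [hτ, Measure.add_apply, Measure.smul_apply, Measure.map_apply hlam_meas measurableSet_Icc.compl,
      Measure.dirac_apply' _ measurableSet_Icc.compl, Set.indicator_of_notMem (by simp), smul_zero, zero_add]
    refine hνρ (measure_mono_null (fun s hs => ?_) (ae_iff.1 hae))
    intro hs1
    obtain ⟨h0, h1⟩ := cheb_lambda_mem hs1
    exact hs ⟨h0.le, h1.le⟩
  · -- moments
    obtain ⟨k, rfl⟩ : ∃ k, n = k + 1 := ⟨n - 1, by omega⟩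
    simp only [Nat.add_sub_cancel]
    have hf_meas : Measurable fun t : ℝ => t ^ k := by fun_prop
    have hint_dirac : Integrable (fun t : ℝ => t ^ k) ((π * β).toNNReal • Measure.dirac 0) :=
      (AxisSpectral.integrable_dirac_real _ 0).smul_measure_nnreal
    have hint_comp : Integrable (fun s : ℝ => (lam s) ^ k) ν := by
      refine Integrable.mono' (integrable_const 1) (hlam_meas.pow_const k).aestronglyMeasurable ?_
      filter_upwards [haeν] with s hs
      obtain ⟨h0, h1⟩ := cheb_lambda_mem hs
      rw [Real.norm_eq_abs, abs_of_nonneg (pow_nonneg h0.le _)]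
      exact pow_le_one₀ h0.le h1.le
    have hint_map : Integrable (fun t : ℝ => t ^ k) (ν.map lam) :=
      (integrable_map_measure hf_meas.aestronglyMeasurable hlam_meas.aemeasurable).2 hint_comp
    rw [hτ, integral_add_measure hint_dirac hint_map, integral_smul_nnreal_measure, integral_dirac,
      integral_map hlam_meas.aemeasurable hf_meas.aestronglyMeasurable]
    -- the atom
    have hatom : ((π * β).toNNReal • ((0 : ℝ) ^ k) : ℝ) = π * β * (if k + 1 = 1 then 1 else 0) := by
      rw [NNReal.smul_def, smul_eq_mul, Real.coe_toNNReal _ (by positivity)]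
      rcases Nat.eq_zero_or_pos k with hk | hk
      · subst hk; simp
      · rw [zero_pow hk.ne', if_neg (by omega)]
    rw [hatom]
    congr 1
    -- the density
    rw [hν, integral_withDensity_eq_integral_toReal_smul hd_meas.ennreal_ofReal
      (Eventually.of_forall fun s => ENNReal.ofReal_lt_top), ← MeasureTheory.integral_const_mul]
    refine integral_congr_ae ?_
    filter_upwards [hae] with s hs
    have h1 : (ENNReal.ofReal (d s)).toReal = d s := ENNReal.toReal_ofReal (hd_nonneg s hs)
    simp only [h1, smul_eq_mul]
    simp only [hd, hlam]
    rw [pow_succ]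
    ring

/-! ### The Pick inversion theorem -/

/-- The Poisson transform of a measure on `[0, 1]` is nonnegative at real `x ≤ 1`. [folklore] -/
theorem poissonTransform_real_nonneg (μ : Measure ℝ) (hμ : μ (Set.Icc (0 : ℝ) 1)ᶜ = 0) {x : ℝ} (hx : x ≤ 1) :
    0 ≤ ∫ t, (1 - t ^ 2) / (1 - 2 * t * x + t ^ 2) ∂μ := by
  have hae : ∀ᵐ t ∂μ, t ∈ Set.Icc (0 : ℝ) 1 := by
    rw [ae_iff]; simpa only [Set.mem_setOf_eq, ← Set.mem_compl_iff, Set.setOf_mem_eq] using hμ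
  refine integral_nonneg_of_ae (hae.mono fun t ht => ?_)
  refine div_nonneg (by nlinarith [ht.1, ht.2]) ?_
  nlinarith [ht.1, ht.2, mul_nonneg ht.1 (sub_nonneg.2 hx)]

/-- **Pick inversion for reciprocal Poisson mixtures** (THE LEVER, abstract form). Let `g` be
continuous, even, `2π`-periodic and positive, with `∫_{-π}^{π} g(θ) cos(nθ) dθ = ∫ tⁿ dμ(t)` for a
finite positive measure `μ` on `[0, 1]` and all `n : ℕ`, and let `1/g(θ) = ∑ₘ cₘ cos(mθ)` with
`∑ |cₘ| < ∞`. Then there is a finite positive measure `τ` on `[0, 1]` such that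
`-cₙ/2 = ∫ t^{n-1} dτ(t)` for every `n ≥ 1`. [folklore] -/
theorem hausdorff_of_inv_hasSum_cos {g : ℝ → ℝ} (hg : Continuous g)
    (hper : Function.Periodic g (2 * π)) (heven : ∀ θ, g (-θ) = g θ) (hpos : ∀ θ, 0 < g θ)
    {μ : Measure ℝ} [IsFiniteMeasure μ] (hμ : μ (Set.Icc (0 : ℝ) 1)ᶜ = 0)
    (hmom : ∀ n : ℕ, ∫ θ in (-π)..π, g θ * Real.cos (n * θ) = ∫ t, t ^ n ∂μ)
    {c : ℕ → ℝ} (hc : Summable c) (hsum : ∀ θ, HasSum (fun m : ℕ => c m * Real.cos (m * θ)) (g θ)⁻¹) :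
    ∃ τ : Measure ℝ, IsFiniteMeasure τ ∧ τ (Set.Icc (0 : ℝ) 1)ᶜ = 0 ∧
      ∀ n : ℕ, 1 ≤ n → -(c n) / 2 = ∫ t, t ^ (n - 1) ∂τ := by
  have hπ := Real.pi_pos
  have hae : ∀ᵐ t ∂μ, t ∈ Set.Icc (0 : ℝ) 1 := by
    rw [ae_iff]; simpa only [Set.mem_setOf_eq, ← Set.mem_compl_iff, Set.setOf_mem_eq] using hμ
  -- Step 1: the Poisson representation `2π g θ = F(cos θ)`
  have hrepr : ∀ θ : ℝ, Real.cos θ ≠ 1 →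
      2 * π * g θ = ∫ t, (1 - t ^ 2) / (1 - 2 * t * Real.cos θ + t ^ 2) ∂μ :=
    fun θ hθ => two_pi_mul_eq_integral_poisson hg hper heven hμ hmom hθ
  -- Step 2: `μ` charges `[0, 1)`
  have hμ0 : μ (Set.Ico (0 : ℝ) 1) ≠ 0 := by
    intro h0
    have hae1 : ∀ᵐ t ∂μ, t = 1 := by
      rw [ae_iff]
      refine measure_mono_null (fun t ht => ?_) (measure_union_null hμ h0)
      by_cases h : t ∈ Set.Icc (0 : ℝ) 1
      · exact Or.inr ⟨h.1, lt_of_le_of_ne h.2 ht⟩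
      · exact Or.inl h
    have h1 := hrepr π (by rw [Real.cos_pi]; norm_num)
    rw [integral_congr_ae (hae1.mono fun t ht => show (1 - t ^ 2) / (1 - 2 * t * Real.cos π + t ^ 2) = (0 : ℝ) by
      rw [ht]; norm_num), integral_zero] at h1
    have := hpos π
    nlinarith
  -- Step 3: Nevanlinna data, no atom at 1, integrability of `1/(s(s-1))`
  obtain ⟨b, β, ρ, hβ, hρ, hρ1, hrep⟩ := exists_nevanlinna_repr_neg_inv_poissonTransform μ hμ hμ0
  obtain ⟨hρpt, hu⟩ := integrable_inv_mul_sub_one_of_repr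
    (A := fun x => -(∫ t, (1 - t ^ 2) / (1 - 2 * t * x + t ^ 2) ∂μ)⁻¹) hρ hρ1 hrep
    (fun x _ hx1 => neg_nonpos.2 (inv_nonneg.2 (poissonTransform_real_nonneg μ hμ hx1.le)))
  have hae' : ∀ᵐ s ∂ρ, 1 < s := ae_one_lt_of_null hρ1 hρpt
  haveI : SigmaFinite ρ := sigmaFinite_of_integrable_inv hρ
  -- Step 4: the pointwise identity for `1/g`
  have hkey : ∀ θ : ℝ, Real.cos θ ≠ 1 → (g θ)⁻¹ = -(2 * π * b) * Real.cos ((0 : ℕ) * θ) +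
      -(2 * π * β) * (Real.cos ((1 : ℕ) * θ) * 1) +
      -2 * ∫ s, ((s - Real.cos θ)⁻¹ - s / (1 + s ^ 2)) ∂ρ := by
    intro θ hθ
    have hlt : Real.cos θ < 1 := lt_of_le_of_ne (Real.cos_le_one θ) hθ
    have h1 := hrepr θ hθ
    have h2 := hrep (Real.cos θ) hlt
    have hgθ := hpos θ
    have hF : (∫ t, (1 - t ^ 2) / (1 - 2 * t * Real.cos θ + t ^ 2) ∂μ) = 2 * π * g θ := h1.symm
    rw [hF] at h2
    simp only [Nat.cast_zero, zero_mul, Real.cos_zero, mul_one, Nat.cast_one, one_mul]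
    have : (g θ)⁻¹ = -(2 * π) * (-(2 * π * g θ)⁻¹) := by field_simp
    rw [this, h2]
    field_simp
    ring
  -- Step 5: the cosine coefficients, two ways
  have hcoef : ∀ n : ℕ, 1 ≤ n → π * c n = -(2 * π * β) * (if 1 = n then π else 0) +
      -2 * ∫ s, 2 * π * (s - Real.sqrt (s ^ 2 - 1)) ^ n / Real.sqrt (s ^ 2 - 1) ∂ρ := by
    intro n hn
    obtain ⟨hI, hIval⟩ := integral_nevanlinna_integral_mul_cos hae' hu hn
    rw [← integral_mul_cos_of_hasSum_cos hc hsum hn]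
    have hcongr : ∫ θ in (-π)..π, (g θ)⁻¹ * Real.cos (n * θ) = ∫ θ in (-π)..π,
        (-(2 * π * b) * (Real.cos ((0 : ℕ) * θ) * Real.cos (n * θ)) +
          -(2 * π * β) * (Real.cos ((1 : ℕ) * θ) * Real.cos (n * θ)) +
          -2 * ((∫ s, ((s - Real.cos θ)⁻¹ - s / (1 + s ^ 2)) ∂ρ) * Real.cos (n * θ))) := by
      refine intervalIntegral.integral_congr_ae (ae_cos_ne_one.mono fun θ hθ hmem => ?_)
      rw [hkey θ (hθ hmem)]
      simp only [mul_one]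
      ring
    have hi0 : IntervalIntegrable (fun θ => -(2 * π * b) * (Real.cos ((0 : ℕ) * θ) * Real.cos (n * θ))) volume (-π) π :=
      Continuous.intervalIntegrable (by fun_prop) _ _
    have hi1 : IntervalIntegrable (fun θ => -(2 * π * β) * (Real.cos ((1 : ℕ) * θ) * Real.cos (n * θ))) volume (-π) π :=
      Continuous.intervalIntegrable (by fun_prop) _ _
    rw [hcongr, intervalIntegral.integral_add (hi0.add hi1) (hI.const_mul _), intervalIntegral.integral_add hi0 hi1,
      intervalIntegral.integral_const_mul, intervalIntegral.integral_const_mul, intervalIntegral.integral_const_mul,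
      hIval, integral_cos_mul_cos le_rfl hn]
    simp only [Nat.cast_zero, zero_mul, Real.cos_zero, one_mul]
    rw [integral_cos_nat_mul, if_neg (by omega)]
    ring
  -- Step 6: the measure
  obtain ⟨τ, hτfin, hτsupp, hτmom⟩ := exists_shifted_moment_measure hβ hae' hu
  refine ⟨τ, hτfin, hτsupp, fun n hn => ?_⟩
  rw [hτmom n hn]
  have h := hcoef n hn
  have hI2 : ∫ s, 2 * π * (s - Real.sqrt (s ^ 2 - 1)) ^ n / Real.sqrt (s ^ 2 - 1) ∂ρ =
      2 * π * ∫ s, (s - Real.sqrt (s ^ 2 - 1)) ^ n / Real.sqrt (s ^ 2 - 1) ∂ρ := by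
    rw [← MeasureTheory.integral_const_mul]
    exact integral_congr_ae (Eventually.of_forall fun s => by ring)
  rw [hI2] at h
  by_cases h1 : n = 1
  · subst h1
    simp only [if_true] at h ⊢
    have : c 1 = -(2 * π * β) - 4 * ∫ s, (s - Real.sqrt (s ^ 2 - 1)) ^ 1 / Real.sqrt (s ^ 2 - 1) ∂ρ := by
      apply mul_left_cancel₀ hπ.ne'
      rw [h]; ring
    rw [this]; ring
  · rw [if_neg (Ne.symm h1)] at h
    rw [if_neg h1]
    have : c n = -4 * ∫ s, (s - Real.sqrt (s ^ 2 - 1)) ^ n / Real.sqrt (s ^ 2 - 1) ∂ρ := by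
      apply mul_left_cancel₀ hπ.ne'
      rw [h]; ring
    rw [this]; ring

/-- **Registered auxiliary stub `stub_pickInversion_auxPickInversion`** (sub-goal of
`stub_pickInversion`): the abstract Pick inversion theorem `hausdorff_of_inv_hasSum_cos`. [folklore] -/
theorem stub_pickInversion_auxPickInversion : ∀ (g : ℝ → ℝ) (μ : MeasureTheory.Measure ℝ) (c : ℕ → ℝ),
    Continuous g → Function.Periodic g (2 * Real.pi) → (∀ θ : ℝ, g (-θ) = g θ) → (∀ θ : ℝ, 0 < g θ) →
    MeasureTheory.IsFiniteMeasure μ → μ (Set.Icc (0 : ℝ) 1)ᶜ = 0 →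
    (∀ n : ℕ, ∫ θ in (-Real.pi)..Real.pi, g θ * Real.cos (n * θ) = ∫ t, t ^ n ∂μ) →
    Summable c → (∀ θ : ℝ, HasSum (fun m : ℕ => c m * Real.cos (m * θ)) (g θ)⁻¹) →
    ∃ τ : MeasureTheory.Measure ℝ, MeasureTheory.IsFiniteMeasure τ ∧ τ (Set.Icc (0 : ℝ) 1)ᶜ = 0 ∧
      ∀ n : ℕ, 1 ≤ n → -(c n) / 2 = ∫ t, t ^ (n - 1) ∂τ :=
  fun _ _ _ hg hper heven hpos hfin hμ hmom hc hsum => by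
    haveI := hfin
    exact hausdorff_of_inv_hasSum_cos hg hper heven hpos hμ hmom hc hsum

end Summit.CriticalPhenomena.Ising3DConformalLimit.Cruxes.DirectCorrelationStableTail.SelfEnergyPickInversion

end
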